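import Literature.NumberTheory.GelbartRogawski1991.UnitaryDualPairThetaKernelCM
import HarnessLib

/-!
# Gelbart–Rogawski 1991, §3.1: the dual-pair splitting datum is NON-DEGENERATE — `ι` is injective,
# `-1 ∈ G₁(𝔸_F)` is non-trivial, and the constant section is not a compatible splitting

Topic `NumberTheory/GelbartRogawski1991`; namespace `Literature.NumberTheory.GelbartRogawski1991.UnitaryDualPair`
(companion of `UnitaryDualPairSplittingDatum` and of the CM instance `cmSplittingDatum` of
`UnitaryDualPairThetaKernelCM`, the datum at which `GRConstruction.gru_shape` (`CompatibleSplittingCM`) proves the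
record `SplittingDatum.CompatibleSplitting` = [GelbartRogawski1991, §3.1 Prop. 3.1.1, p. 455 L1–3]).
KERNEL ONLY: 0 def / 0 structure / 0 axiom / 0 named fact; every declaration is a PROVED elementary lemma about
objects already constructed in the tree (cite tags locate the printed context — p. 454 L43–48: `G` the unitary group
of `(V, Φ)` INSIDE `Sp(W)`, `W = V` viewed over `F`; p. 455 L1–3: Prop. 3.1.1 — nothing printed is asserted).

PURPOSE.  The record typing `D.CompatibleSplitting := ∃ s : G(𝔸) →* Mp, Continuous s ∧ D.IsCompatible s` has ONE
vacuity channel: if `ι = D.toSp : G(𝔸) → Sp_𝔸(W)` is the trivial homomorphism, the CONSTANT section `s := 1` is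
compatible and the record is inhabited for free (conversely `D.IsCompatible 1 → ι = 1`,
`SplittingDatum.toSp_eq_one_of_isCompatible_one`).  This file shows that the dual-pair datum of the tree — and in
particular the CM datum of `gru_shape` — lies OUTSIDE that channel as soon as the index `Fin N × Fin M` of
`G₁ = U(J_V ⊗ J_W)` is non-empty:
* `UnitaryDualPair.toSp_injective` — `ι : G₁(𝔸_F) → Sp(𝕎_𝔸)` (restriction of scalars `E → F` on adelic points,
  `adelicPairToSymplectic`, followed by the reindexing `spReindex e`) is INJECTIVE
  (`adelicPairToSymplectic_injective`, `spReindex_injective`); so `ι = 1` iff `G₁(𝔸_F)` is trivial;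
* `UnitaryGroup.neg_one_mem_adelicPair` — the scalar `-1 ∈ GL_{NM}(𝔸_E)` lies in `G₁(𝔸_F) = U(J_V ⊗ J_W)(𝔸_F)`
  (`(σ(-1))ᵀ H (-1) = H` for every form `H`); `negOne_ne_one` — it is `≠ 1` for `N ≠ 0 ≠ M` (`-1 ≠ 1` in the
  number field `E`, and `E → 𝔸_E` is injective, `NumberField.AdeleRing.algebraMap_injective`);
* `toSp_negOne_ne_one` / `exists_toSp_ne_one` — **`ι(-1) ≠ 1`**: an explicit adelic unitary element with
  non-trivial symplectic image; `splittingDatum_not_isCompatible_one` — the constant section `1` is NOT a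
  compatible splitting of `UnitaryDualPair.splittingDatum`;
* the CM specialisations (`F := L⁺`, `E := L`, `c :=` complex conjugation, diagonal forms; `[NeZero N] [NeZero M]`):
  `cmSplittingDatum_toSp_injective`, `cmSplittingDatum_toSp_negOne_ne_one`, `cmSplittingDatum_exists_toSp_ne_one`,
  `cmSplittingDatum_not_isCompatible_one` — the witness of `GRConstruction.gru_shape` is a genuine continuous
  homomorphic section of `π` over an injective `ι`, not the vacuity-channel inhabitant.
At `N = 0` or `M = 0` the index is empty, `G₁(𝔸_F)` is the trivial group and the channel applies (the honest
degenerate slice of the record).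

References: S. Gelbart, J. Rogawski, *L-functions and Fourier–Jacobi coefficients for the unitary group U(3)*,
Invent. Math. 105 (1991) 445–472, §3.1 pp. 454–455 [GelbartRogawski1991] (the datum and Prop. 3.1.1; nothing of the
paper is transcribed here — the lemmas are elementary facts about the tree's constructed datum).
-/

set_option autoImplicit false

noncomputable section

open scoped Matrix Kronecker
open NumberField
open Literature.NumberTheory.Automorphic
open Literature.RepresentationTheory.HeisenbergGroup

namespace Literature.NumberTheory.GelbartRogawski1991

namespace UnitaryDualPair

/-! ## §1. The generic dual-pair datum: `ι` injective, `-1 ∈ G₁(𝔸_F)`, `ι(-1) ≠ 1` -/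

section Generic

variable (F E : Type) [Field F] [NumberField F] [Field E] [NumberField E] [Algebra F E]
variable (c : E ≃ₐ[F] E) (N M : ℕ) {n : ℕ} (e : Fin N × Fin M ≃ Fin n)
variable (JV : Matrix (Fin N) (Fin N) E) (JW : Matrix (Fin M) (Fin M) E)

/-- **`ι : G₁(𝔸_F) → Sp(𝕎_𝔸)` is injective** (restriction of scalars is, and reindexing is). [cite: GelbartRogawski1991, §3.1 p. 454 L43–48] -/
theorem toSp_injective [Algebra.IsQuadraticExtension F E] {δ : E} (hcδ : c δ = -δ) (hδ : δ ≠ 0) {d : F}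
    (hd : δ * δ = algebraMap F E d) {TV : Matrix (Fin N) (Fin N) F} {TW : Matrix (Fin M) (Fin M) F}
    (hV : TV.IsSymm) (hW : TW.IsSymm) (hJV : JV = TV.map (algebraMap F E)) (hJW : JW = TW.map (algebraMap F E)) :
    Function.Injective (toSp F E c N M e JV JW hcδ hδ hd hV hW hJV hJW) :=
  (UnitaryGroup.spReindex_injective e _).comp
    (UnitaryGroup.adelicPairToSymplectic_injective F E c N M hcδ hδ hd hV hW hJV hJW)

omit [NumberField F] in
/-- **`-1 ∈ G₁(𝔸_F) = U(J_V ⊗ J_W)(𝔸_F)`**: the scalar `-1 ∈ GL_{NM}(𝔸_E)` preserves every form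
(`(σ(-1))ᵀ H (-1) = H`). [cite: GelbartRogawski1991, §3.1 p. 454 L43–48] -/
theorem _root_.Literature.NumberTheory.Automorphic.UnitaryGroup.neg_one_mem_adelicPair :
    (-1 : GL (Fin N × Fin M) (AdeleRing (𝓞 E) E)) ∈ UnitaryGroup.adelicPair F E c N M JV JW := by
  rw [UnitaryGroup.mem_adelicPair_iff, Units.val_neg, Units.val_one,
    Matrix.map_neg _ (fun a => map_neg (UnitaryGroup.conjAdele F E c) a), Matrix.transpose_neg,
    Matrix.map_one _ (map_zero _) (map_one _), Matrix.transpose_one, neg_mul, one_mul, neg_mul, mul_neg, mul_one,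
    neg_neg]

omit [NumberField F] in
/-- **`-1 ≠ 1` in `G₁(𝔸_F)`** as soon as the index `Fin N × Fin M` is non-empty (`-1 ≠ 1` in the number field `E`,
embedded in `𝔸_E` by the injective `algebraMap`). [cite: GelbartRogawski1991, §3.1 p. 454 L43–48] -/
theorem negOne_ne_one [NeZero N] [NeZero M] :
    (⟨-1, UnitaryGroup.neg_one_mem_adelicPair F E c N M JV JW⟩ : UnitaryGroup.adelicPair F E c N M JV JW) ≠ 1 := by
  intro h
  have h0 : (-1 : GL (Fin N × Fin M) (AdeleRing (𝓞 E) E)) = 1 := congrArg Subtype.val h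
  have h1 := congrArg (fun g : GL (Fin N × Fin M) (AdeleRing (𝓞 E) E) =>
    (g : Matrix (Fin N × Fin M) (Fin N × Fin M) (AdeleRing (𝓞 E) E)) ((0 : Fin N), (0 : Fin M))
      ((0 : Fin N), (0 : Fin M))) h0
  simp only [Units.val_neg, Units.val_one, Matrix.neg_apply, Matrix.one_apply_eq] at h1
  have h2 : algebraMap E (AdeleRing (𝓞 E) E) (-1) = algebraMap E (AdeleRing (𝓞 E) E) 1 := by
    rw [map_neg, map_one, h1]
  have h3 := AdeleRing.algebraMap_injective (𝓞 E) E h2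
  norm_num at h3

/-- **`ι(-1) ≠ 1`**: ONE explicit adelic unitary element with non-trivial symplectic image. [cite: GelbartRogawski1991, §3.1 p. 454 L43–48] -/
theorem toSp_negOne_ne_one [NeZero N] [NeZero M] [Algebra.IsQuadraticExtension F E] {δ : E} (hcδ : c δ = -δ)
    (hδ : δ ≠ 0) {d : F} (hd : δ * δ = algebraMap F E d) {TV : Matrix (Fin N) (Fin N) F}
    {TW : Matrix (Fin M) (Fin M) F} (hV : TV.IsSymm) (hW : TW.IsSymm) (hJV : JV = TV.map (algebraMap F E))
    (hJW : JW = TW.map (algebraMap F E)) :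
    toSp F E c N M e JV JW hcδ hδ hd hV hW hJV hJW ⟨-1, UnitaryGroup.neg_one_mem_adelicPair F E c N M JV JW⟩ ≠ 1 :=
  fun h => negOne_ne_one F E c N M JV JW
    (toSp_injective F E c N M e JV JW hcδ hδ hd hV hW hJV hJW (h.trans (map_one _).symm))

/-- hence `∃ g ∈ G₁(𝔸_F), ι g ≠ 1` (`N ≠ 0 ≠ M`). [cite: GelbartRogawski1991, §3.1 p. 454 L43–48] -/
theorem exists_toSp_ne_one [NeZero N] [NeZero M] [Algebra.IsQuadraticExtension F E] {δ : E} (hcδ : c δ = -δ)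
    (hδ : δ ≠ 0) {d : F} (hd : δ * δ = algebraMap F E d) {TV : Matrix (Fin N) (Fin N) F}
    {TW : Matrix (Fin M) (Fin M) F} (hV : TV.IsSymm) (hW : TW.IsSymm) (hJV : JV = TV.map (algebraMap F E))
    (hJW : JW = TW.map (algebraMap F E)) :
    ∃ g, toSp F E c N M e JV JW hcδ hδ hd hV hW hJV hJW g ≠ 1 :=
  ⟨_, toSp_negOne_ne_one F E c N M e JV JW hcδ hδ hd hV hW hJV hJW⟩

/-- abstract form (any splitting datum): if the CONSTANT section `1` is compatible then `ι = 1` — the vacuity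
channel of the record typing `SplittingDatum.CompatibleSplitting` is exactly "`ι` trivial". [cite: GelbartRogawski1991, §3.1 Prop. 3.1.1 p. 455 L1–3] -/
theorem _root_.Literature.NumberTheory.GelbartRogawski1991.SplittingDatum.toSp_eq_one_of_isCompatible_one
    {Sp Mp GA : Type*} [Group Sp] [Group Mp] [Group GA] (D : SplittingDatum Sp Mp GA) (h : D.IsCompatible 1)
    (g : GA) : D.toSp g = 1 := by
  have h1 := h.1 g
  rw [MonoidHom.one_apply, map_one] at h1
  exact h1.symm

/-- **the constant section `1` is NOT a compatible splitting of the dual-pair datum** (`N ≠ 0 ≠ M`): the datum lies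
outside the vacuity channel `ι = 1` of the record typing `SplittingDatum.CompatibleSplitting`. [cite: GelbartRogawski1991, §3.1 Prop. 3.1.1 p. 455 L1–3] -/
theorem splittingDatum_not_isCompatible_one [NeZero N] [NeZero M] [Algebra.IsQuadraticExtension F E] {δ : E}
    (hcδ : c δ = -δ) (hδ : δ ≠ 0) {d : F} (hd : δ * δ = algebraMap F E d) {TV : Matrix (Fin N) (Fin N) F}
    {TW : Matrix (Fin M) (Fin M) F} (hV : TV.IsSymm) (hW : TW.IsSymm) (hVd : IsUnit TV.det) (hWd : IsUnit TW.det)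
    (hJV : JV = TV.map (algebraMap F E)) (hJW : JW = TW.map (algebraMap F E)) :
    ¬ (splittingDatum F E c N M e JV JW hcδ hδ hd hV hW hVd hWd hJV hJW).IsCompatible 1 := by
  intro h
  have h1 := (splittingDatum F E c N M e JV JW hcδ hδ hd hV hW hVd hWd hJV hJW).toSp_eq_one_of_isCompatible_one h
    ⟨-1, UnitaryGroup.neg_one_mem_adelicPair F E c N M JV JW⟩
  rw [splittingDatum_toSp] at h1
  exact toSp_negOne_ne_one F E c N M e JV JW hcδ hδ hd hV hW hJV hJW h1

end Generic

/-! ## §2. The CM datum of `GRConstruction.gru_shape` -/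

section CM

variable (L : Type) [Field L] [NumberField L] [IsCMField L] {N M n : ℕ} (e : Fin N × Fin M ≃ Fin n)
variable (dV : Fin N → L) (hdV : ∀ i, IsCMField.complexConj L (dV i) = dV i) (hdV0 : ∀ i, dV i ≠ 0)
variable (dW : Fin M → L) (hdW : ∀ i, IsCMField.complexConj L (dW i) = dW i) (hdW0 : ∀ i, dW i ≠ 0)

/-- **`ι` of the CM datum is injective.** [cite: GelbartRogawski1991, §3.1 p. 454 L43–48] -/
theorem cmSplittingDatum_toSp_injective :
    Function.Injective (cmSplittingDatum L e dV hdV hdV0 dW hdW hdW0).toSp :=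
  toSp_injective (↥(maximalRealSubfield L)) L (IsCMField.complexConj L) N M e (Matrix.diagonal dV)
    (Matrix.diagonal dW) (complexConj_imagUnit L) (imagUnit_ne_zero L) (imagUnit_mul_self L)
    (realDiagonal_isSymm L dV hdV) (realDiagonal_isSymm L dW hdW)
    (realDiagonal_map L dV hdV).symm (realDiagonal_map L dW hdW).symm

/-- **`ι(-1) ≠ 1` at the CM datum** — one explicit adelic unitary element with non-trivial symplectic image at
`cmSplittingDatum` (`N ≠ 0 ≠ M`). [cite: GelbartRogawski1991, §3.1 Prop. 3.1.1 p. 455 L1–3] -/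
theorem cmSplittingDatum_toSp_negOne_ne_one [NeZero N] [NeZero M] :
    (cmSplittingDatum L e dV hdV hdV0 dW hdW hdW0).toSp
        ⟨-1, UnitaryGroup.neg_one_mem_adelicPair (↥(maximalRealSubfield L)) L (IsCMField.complexConj L) N M
          (Matrix.diagonal dV) (Matrix.diagonal dW)⟩ ≠ 1 :=
  toSp_negOne_ne_one (↥(maximalRealSubfield L)) L (IsCMField.complexConj L) N M e (Matrix.diagonal dV)
    (Matrix.diagonal dW) (complexConj_imagUnit L) (imagUnit_ne_zero L) (imagUnit_mul_self L)
    (realDiagonal_isSymm L dV hdV) (realDiagonal_isSymm L dW hdW)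
    (realDiagonal_map L dV hdV).symm (realDiagonal_map L dW hdW).symm

/-- hence `∃ g, ι g ≠ 1` at the CM datum. [cite: GelbartRogawski1991, §3.1 Prop. 3.1.1 p. 455 L1–3] -/
theorem cmSplittingDatum_exists_toSp_ne_one [NeZero N] [NeZero M] :
    ∃ g, (cmSplittingDatum L e dV hdV hdV0 dW hdW hdW0).toSp g ≠ 1 :=
  ⟨_, cmSplittingDatum_toSp_negOne_ne_one L e dV hdV hdV0 dW hdW hdW0⟩

/-- **the constant section is NOT a compatible splitting of the CM datum** (`N ≠ 0 ≠ M`): `GRConstruction.gru_shape`'s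
witness is a genuine section of `π` over a non-trivial (injective) `ι`, not the vacuity-channel inhabitant. [cite: GelbartRogawski1991, §3.1 Prop. 3.1.1 p. 455 L1–3] -/
theorem cmSplittingDatum_not_isCompatible_one [NeZero N] [NeZero M] :
    ¬ (cmSplittingDatum L e dV hdV hdV0 dW hdW hdW0).IsCompatible 1 :=
  splittingDatum_not_isCompatible_one (↥(maximalRealSubfield L)) L (IsCMField.complexConj L) N M e
    (Matrix.diagonal dV) (Matrix.diagonal dW) (complexConj_imagUnit L) (imagUnit_ne_zero L) (imagUnit_mul_self L)
    (realDiagonal_isSymm L dV hdV) (realDiagonal_isSymm L dW hdW)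
    (isUnit_det_realDiagonal L dV hdV hdV0) (isUnit_det_realDiagonal L dW hdW hdW0)
    (realDiagonal_map L dV hdV).symm (realDiagonal_map L dW hdW).symm

end CM

end UnitaryDualPair

end Literature.NumberTheory.GelbartRogawski1991

end
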